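import Mathlib
import Summits.Ventures.PercRepro2.Defs
import Summits.Ventures.PercRepro2.Independence
import Summits.Ventures.PercRepro2.Harris
import Summits.Ventures.PercRepro2.Graph
import Summits.Ventures.PercRepro2.Exploration
import Summits.Ventures.PercRepro2.Events
import Summits.Ventures.PercRepro2.FourFunctions
import Summits.Ventures.PercRepro2.Induced
import Summits.Ventures.PercRepro2.Frontier
import Summits.Ventures.PercRepro2.ObsIndependence
import Summits.Ventures.PercRepro2.BHK
import Summits.Ventures.PercRepro2.BHKEvents
import Summits.Ventures.PercRepro2.SideAgreement
import Summits.Ventures.PercRepro2.VdBKahn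
import Summits.Ventures.PercRepro2.BHKAvoid
import Summits.Ventures.PercRepro2.R2PrimeThreeReduction
import Summits.Ventures.PercRepro2.YBridge
import Summits.Ventures.PercRepro2.Yu1Functionals
import Summits.Ventures.PercRepro2.Yu1Events
import Summits.Ventures.PercRepro2.Yu1
import Summits.Ventures.PercRepro2.LBSplit
import Summits.Ventures.PercRepro2.YDelta
import Summits.Ventures.PercRepro2.SD
import Summits.Ventures.PercRepro2.Threshold
import Summits.Ventures.PercRepro2.Lambda
import Summits.Ventures.PercRepro2.LambdaTau
import Summits.Ventures.PercRepro2.LambdaSlack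
import Summits.Ventures.PercRepro2.HF2
import Summits.Ventures.PercRepro2.Yu2
import Summits.Ventures.PercRepro2.N0
import Summits.Ventures.PercRepro2.Y
import Summits.Ventures.PercRepro2.YDeltaTools
import Summits.Ventures.PercRepro2.ZDelta
import Summits.Ventures.PercRepro2.ZExpand
import Summits.Ventures.PercRepro2.ISplit
import Summits.Ventures.PercRepro2.MRl
import Summits.Ventures.PercRepro2.ZOloc

/-!
# Side agreement in the `Z` vocabulary (blind cell PercRepro2, typer-1; mine-1 g6 ask
2026-08-23T03:51:32Z on `SideAgreement.lean`)

mine-1's `side_agreement` / `same_side_ge_opp_side_of_tie` are stated on the events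
`connEvent l o ∩ connEvent h b ∩ (connEvent l h)ᶜ`; the `Z`-files (`ZOloc`, `ZAnatomy`) write the
same `Q`-world masses as `avoidAll a₂ {a₁} ∩ connEvent a₁ o ∩ connEvent a₂ b` (`Q = avoidAll a₂ {a₁}`).
The bridge:
* `compl_conn_eq_avoidAll`: `(connEvent a₁ a₂)ᶜ = avoidAll a₂ {a₁}`; `inter_compl_conn_eq`: the event
  reordering;
* `sameSide := P(Q, oL, bL) + P(Q, oH, bH)`, `oppSide := P(Q, oL, bH) + P(Q, oH, bL)` (`o` and `b` in
  the same / in opposite root clusters on `Q`);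
* **`oppSide_le_sameSide_of_tie`**: at a labelling tie `P(a₁ ↔ b) = P(a₂ ↔ b)` with `P(Q) > 0`,
  `oppSide ≤ sameSide` — mine-1's corollary in the `Z` vocabulary (the a₃-free half of the tie
  statement, MINE-1.md §20.3);
* `side_agreement_Q`: the covariance form `P(Q)·(sameSide − oppSide) ≥ [P(Q,oL) − P(Q,oH)]·[P(Q,bL) − P(Q,bH)]`
  in the same vocabulary (no tie needed).
-/

namespace Summit.Ventures.PercRepro2

namespace SideBridge

section Events

variable {V : Type*} {E : Type*}

/-- `Qᶜ`-style complement = `avoidAll` (`Conn` is symmetric). -/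
lemma compl_conn_eq_avoidAll (ends : E → Sym2 V) (a₁ a₂ : V) :
    (connEvent ends a₁ a₂)ᶜ = avoidAll ends a₂ {a₁} := by
  ext ω
  simp only [Set.mem_compl_iff, mem_connEvent, mem_avoidAll, Finset.mem_singleton, forall_eq]
  exact ⟨fun h h' => h (conn_symm h'), fun h h' => h (conn_symm h')⟩

/-- `A ∩ B ∩ (connEvent a₁ a₂)ᶜ = avoidAll a₂ {a₁} ∩ A ∩ B`. -/
lemma inter_compl_conn_eq (ends : E → Sym2 V) (a₁ a₂ : V) (A B : Set (Config E)) :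
    A ∩ B ∩ (connEvent ends a₁ a₂)ᶜ = avoidAll ends a₂ {a₁} ∩ A ∩ B := by
  rw [compl_conn_eq_avoidAll]
  ext ω
  simp only [Set.mem_inter_iff]
  tauto

/-- `A ∩ (connEvent a₁ a₂)ᶜ = avoidAll a₂ {a₁} ∩ A`. -/
lemma inter_compl_conn_eq' (ends : E → Sym2 V) (a₁ a₂ : V) (A : Set (Config E)) :
    A ∩ (connEvent ends a₁ a₂)ᶜ = avoidAll ends a₂ {a₁} ∩ A := by
  rw [compl_conn_eq_avoidAll, Set.inter_comm]

end Events

section Defs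

variable {V : Type*} {E : Type*} [Fintype E] [DecidableEq E] [DecidableEq V] {R : Type*}
  [CommRing R]

/-- `SAME := P(Q, oL, bL) + P(Q, oH, bH)` — `o` and `b` in the same root cluster on `Q`. -/
noncomputable def sameSide (p : E → R) (ends : E → Sym2 V) (o a₁ a₂ b : V) : R :=
  prob p (avoidAll ends a₂ {a₁} ∩ connEvent ends a₁ o ∩ connEvent ends a₁ b) +
    prob p (avoidAll ends a₂ {a₁} ∩ connEvent ends a₂ o ∩ connEvent ends a₂ b)

/-- `OPP := P(Q, oL, bH) + P(Q, oH, bL)` — `o` and `b` in opposite root clusters on `Q`. -/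
noncomputable def oppSide (p : E → R) (ends : E → Sym2 V) (o a₁ a₂ b : V) : R :=
  prob p (avoidAll ends a₂ {a₁} ∩ connEvent ends a₁ o ∩ connEvent ends a₂ b) +
    prob p (avoidAll ends a₂ {a₁} ∩ connEvent ends a₂ o ∩ connEvent ends a₁ b)

end Defs

section Bridge

variable {V : Type*} {E : Type*} [Fintype E] [DecidableEq E] [Fintype V] [DecidableEq V]
  {R : Type*} [CommRing R] [LinearOrder R] [IsStrictOrderedRing R]

/-- **Side agreement in the `Q` vocabulary**:
`P(Q)·(SAME − OPP) ≥ [P(Q, oL) − P(Q, oH)]·[P(Q, bL) − P(Q, bH)]` (mine-1's `side_agreement`). -/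
theorem side_agreement_Q (p : E → R) (hp : IsProbVec p) (ends : E → Sym2 V) (o a₁ a₂ b : V) :
    (sameSide p ends o a₁ a₂ b - oppSide p ends o a₁ a₂ b) * prob p (avoidAll ends a₂ {a₁}) ≥
      (prob p (avoidAll ends a₂ {a₁} ∩ connEvent ends a₁ o) -
          prob p (avoidAll ends a₂ {a₁} ∩ connEvent ends a₂ o)) *
        (prob p (avoidAll ends a₂ {a₁} ∩ connEvent ends a₁ b) -
          prob p (avoidAll ends a₂ {a₁} ∩ connEvent ends a₂ b)) := by
  have h := side_agreement p hp ends a₁ a₂ o b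
  simp only [inter_compl_conn_eq] at h
  simp only [inter_compl_conn_eq'] at h
  rw [compl_conn_eq_avoidAll] at h
  unfold sameSide oppSide
  nlinarith [h]

/-- **Same side beats opposite side at a labelling tie**, in the `Z` vocabulary: if
`P(a₁ ↔ b) = P(a₂ ↔ b)` and `P(Q) > 0`, then `OPP ≤ SAME` (mine-1's `same_side_ge_opp_side_of_tie`). -/
theorem oppSide_le_sameSide_of_tie (p : E → R) (hp : IsProbVec p) (ends : E → Sym2 V)
    {o a₁ a₂ b : V} (htie : prob p (connEvent ends a₁ b) = prob p (connEvent ends a₂ b))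
    (hQ : 0 < prob p (avoidAll ends a₂ {a₁})) :
    oppSide p ends o a₁ a₂ b ≤ sameSide p ends o a₁ a₂ b := by
  have hQ' : 0 < prob p (connEvent ends a₁ a₂)ᶜ := by rwa [compl_conn_eq_avoidAll]
  have h := same_side_ge_opp_side_of_tie p hp ends a₁ a₂ o b htie hQ'
  simp only [inter_compl_conn_eq] at h
  unfold sameSide oppSide
  linarith [h]

end Bridge

section MQoHLink

variable {V : Type*} {E : Type*} [Fintype E] [DecidableEq E] {R : Type*} [Field R]

/-- `sameSide − oppSide` is the covariance-type bracket of `ZOloc.MQoH`'s world: it splits as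
`MQoH + [P(Q, oL, bL) − P(Q, oL, bH)]`. -/
lemma sameSide_sub_oppSide (p : E → R) (ends : E → Sym2 V) (o a₁ a₂ b : V) :
    sameSide p ends o a₁ a₂ b - oppSide p ends o a₁ a₂ b =
      ZOloc.MQoH p ends o a₁ a₂ b +
        (prob p (avoidAll ends a₂ {a₁} ∩ connEvent ends a₁ o ∩ connEvent ends a₁ b) -
          prob p (avoidAll ends a₂ {a₁} ∩ connEvent ends a₁ o ∩ connEvent ends a₂ b)) := by
  unfold sameSide oppSide ZOloc.MQoH
  ring

end MQoHLink

end SideBridge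

end Summit.Ventures.PercRepro2
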